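import Literature.Probability.LatticeModels.IsingDisorderSeam
import Literature.Probability.LatticeModels.SpinorCornerFlux
import HarnessLib

/-!
# The spin fermion as a spinor section: related corners everywhere, fluxes = Kadanoff–Ceva fluxes

Topic `Literature/Probability/LatticeModels`; glue between the bond-function picture of the signed
critical Kadanoff–Ceva observable `kcObs` (`IsingDisorderObservable.lean`: s-holomorphic at the
corners `(y, NE)`, `(y, NW)` always and at `(y, SW)`, `(y, SE)` when its two sign conventions agree;
`IsingDisorderSeam.lean`: opposite projections when they disagree) and the corner-value picture of
its primitive (`IsingDisorderLaplacian.lean`: the flux form `kcFlux q = X_B(v, T_p)²` and its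
primitive `(Hw, Hb)`), for Chelkak–Hongler–Izyurov 2015, Prop. 2.4 / Prop. 3.6:

* the sign conventions are `±1`-valued (`rowSign_cases`, `hLowSign_cases`, `vLowSign_cases`), so
  at every lower corner ONE of the two statements applies: **`relAt_kcObs_two/three`** (and
  `relAt_kcObs_zero/one`): under the cut-system hypotheses `kcObs` is a related (`RelAt`) bond
  function at every corner — an s-holomorphic spinor section;
* **`cornerFlux_kcObs`**: at every corner `‖Proj[kcObs(e) ; ℓ(q)]‖² = c_KC · X²`,
  `c_KC = (frameNorm 0 0)²/√2` (`kcFluxConst`), i.e. the primitive `Im ∫ kcObs²` of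
  `SHolomorphicPrimitive.lean` is `c_KC · (Hw, Hb)`.

Everything is proved; no named fact.

## References

* D. Chelkak, C. Hongler, K. Izyurov, Ann. of Math. 181 (2015): Prop. 2.4, Prop. 3.6
  [ChelkakHonglerIzyurovAnnals2015].
* S. Smirnov, Ann. of Math. 172 (2010): Lemma 3.6, Remark 3.7 [Smirnov2010].
-/

noncomputable section

namespace Literature.Probability.LatticeModels

open Complex SimpleGraph

/-! ### The sign conventions are `±1` -/

/-- Products of signs are signs. [folklore] -/
theorem pm_mul {a b : ℝ} (ha : a = 1 ∨ a = -1) (hb : b = 1 ∨ b = -1) : a * b = 1 ∨ a * b = -1 := by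
  rcases ha with rfl | rfl <;> rcases hb with rfl | rfl <;> norm_num

/-- `(-1)^n` is a sign. [folklore] -/
theorem neg_one_pow_cases (n : ℕ) : ((-1 : ℝ) ^ n = 1) ∨ ((-1 : ℝ) ^ n = -1) := neg_one_pow_eq_or ℝ n

/-- `rowSign = ±1`. [folklore] -/
theorem rowSign_cases (B : Finset (Site 2)) (r : ℤ) : rowSign B r = 1 ∨ rowSign B r = -1 := neg_one_pow_cases _

/-- `hLowSign = ±1`. [folklore] -/
theorem hLowSign_cases (B : Finset (Site 2)) (v : Site 2) : hLowSign B v = 1 ∨ hLowSign B v = -1 := by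
  unfold hLowSign
  have h := pm_mul (neg_one_pow_cases (rayCountB B s(v, v + cornerUnit 0))) (rowSign_cases B (v 1))
  rcases h with h | h
  · right; linear_combination -h
  · left; linear_combination -h

/-- `vToggleSign = ±1`. [folklore] -/
theorem vToggleSign_cases (T : Finset (Sym2 (Site 2))) (v : Site 2) : vToggleSign T v = 1 ∨ vToggleSign T v = -1 := by
  unfold vToggleSign
  exact pm_mul (kcSign_eq_one_or T _) (neg_one_pow_cases _)

/-- `vLowSign = ±1`. [folklore] -/
theorem vLowSign_cases (B : Finset (Site 2)) (cut : Site 2 → Finset (Sym2 (Site 2))) (x : Site 2) :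
    vLowSign B cut x = 1 ∨ vLowSign B cut x = -1 := by
  unfold vLowSign
  exact pm_mul (vToggleSign_cases _ x) (rowSign_cases B (x 1))

/-- At a lower corner the two sign conventions agree or are opposite. [folklore] -/
theorem hLowSign_eq_or (B : Finset (Site 2)) (cut : Site 2 → Finset (Sym2 (Site 2))) (v x : Site 2) :
    hLowSign B v = vLowSign B cut x ∨ hLowSign B v = -vLowSign B cut x := by
  rcases hLowSign_cases B v with h | h <;> rcases vLowSign_cases B cut x with h' | h' <;> rw [h, h'] <;> norm_num

/-! ### `kcObs` is related at every corner -/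

section Related

variable (G₂ : SimpleGraph (Site 2)) [G₂.LocallyFinite]
variable {Λ : Finset (Site 2)} {η : SpinConfig (Site 2)} {B : Finset (Site 2)} {cut : Site 2 → Finset (Sym2 (Site 2))}

/-- `(y, NE)`: always s-holomorphic, hence related. [cite: ChelkakHonglerIzyurovAnnals2015, Prop. 2.4] -/
theorem relAt_kcObs_zero (hG : ∀ v ∈ Λ, ∀ k : Fin 4, G₂.Adj v (v + cornerUnit k)) (hle : G₂ ≤ zdGraph 2)
    {y : Site 2} (hT : cut (faceAt y 1) ⊆ edgesTouching G₂ Λ) (he : s(y, y + cornerUnit 1) ∈ edgesTouching G₂ Λ)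
    (hstep : KCGaugeEquiv G₂ Λ (symmDiff (cut (faceAt y 1)) {s(y, y + cornerUnit 1)}) (cut (faceAt y 0))) :
    RelAt (kcObs G₂ Λ η B cut) (y, 0) :=
  (isSHolAt_kcObs_zero G₂ hG hle hT he hstep).relAt

/-- `(y, NW)`: always s-holomorphic, hence related. [cite: ChelkakHonglerIzyurovAnnals2015, Prop. 2.4] -/
theorem relAt_kcObs_one (hG : ∀ v ∈ Λ, ∀ k : Fin 4, G₂.Adj v (v + cornerUnit k)) (hle : G₂ ≤ zdGraph 2)
    {y : Site 2} (hT : cut (faceAt y 1) ⊆ edgesTouching G₂ Λ)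
    (he : s(y + cornerUnit 2, y + cornerUnit 2 + cornerUnit 0) ∈ edgesTouching G₂ Λ)
    (hstep : KCGaugeEquiv G₂ Λ (symmDiff (cut (faceAt y 1)) {s(y + cornerUnit 2, y + cornerUnit 2 + cornerUnit 0)})
      (cut (faceAt y 2))) :
    RelAt (kcObs G₂ Λ η B cut) (y, 1) :=
  (isSHolAt_kcObs_one G₂ hG hle hT he hstep).relAt

/-- **`(y, SW)`: related in all cases** — s-holomorphic if the sign conventions agree, opposite
projections (the seam) if they disagree. [cite: ChelkakHonglerIzyurovAnnals2015, Prop. 2.4] -/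
theorem relAt_kcObs_two (hG : ∀ v ∈ Λ, ∀ k : Fin 4, G₂.Adj v (v + cornerUnit k)) (hle : G₂ ≤ zdGraph 2)
    {y : Site 2} (hT : cut (faceAt y 2) ⊆ edgesTouching G₂ Λ)
    (he : s(y + cornerUnit 3, y + cornerUnit 3 + cornerUnit 1) ∈ edgesTouching G₂ Λ)
    (hstep : KCGaugeEquiv G₂ Λ (symmDiff (cut (faceAt y 2)) {s(y + cornerUnit 3, y + cornerUnit 3 + cornerUnit 1)})
      (cut (faceAt y 3))) :
    RelAt (kcObs G₂ Λ η B cut) (y, 2) := by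
  rcases hLowSign_eq_or B cut (y + cornerUnit 2) (y + cornerUnit 3) with hs | hs
  · exact (isSHolAt_kcObs_two G₂ hG hle hT he hstep hs).relAt
  · right
    simp only [cFace, cSrc, cTgt, show (2 : Fin 4) + 1 = 3 from rfl, westBond_eq, southBond_eq, kcObs_east, kcObs_north]
    exact projLine_kcObs_SW_seam G₂ hG hle hT he hstep hs

/-- **`(y, SE)`: related in all cases.** [cite: ChelkakHonglerIzyurovAnnals2015, Prop. 2.4] -/
theorem relAt_kcObs_three (hG : ∀ v ∈ Λ, ∀ k : Fin 4, G₂.Adj v (v + cornerUnit k)) (hle : G₂ ≤ zdGraph 2)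
    {y : Site 2} (hT : cut (faceAt y 0) ⊆ edgesTouching G₂ Λ) (he : s(y, y + cornerUnit 0) ∈ edgesTouching G₂ Λ)
    (hstep : KCGaugeEquiv G₂ Λ (symmDiff (cut (faceAt y 0)) {s(y, y + cornerUnit 0)}) (cut (faceAt y 3))) :
    RelAt (kcObs G₂ Λ η B cut) (y, 3) := by
  rcases hLowSign_eq_or B cut y (y + cornerUnit 3) with hs | hs
  · exact (isSHolAt_kcObs_three G₂ hG hle hT he hstep hs.symm).relAt
  · right
    simp only [cFace, cSrc, cTgt, show (3 : Fin 4) + 1 = 0 from rfl, southBond_eq, kcObs_east, kcObs_north]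
    refine projLine_kcObs_SE_seam G₂ hG hle hT he hstep ?_
    rcases vLowSign_cases B cut (y + cornerUnit 3) with h' | h' <;> rw [h'] at hs ⊢ <;> linarith

end Related

/-! ### The fluxes of `kcObs` are the Kadanoff–Ceva fluxes -/

/-- The proportionality constant between `‖Proj[kcObs ; ℓ]‖²` and `X²`: `(frameNorm 0 0)²/√2`. [folklore] -/
def kcFluxConst : ℝ := frameNorm 0 0 ^ 2 / Real.sqrt 2

/-- `kcFluxConst > 0`. [folklore] -/
theorem kcFluxConst_pos : 0 < kcFluxConst := by
  unfold kcFluxConst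
  exact div_pos (pow_pos (frameNorm_pos 0 0) 2) (Real.sqrt_pos.2 two_pos)

section Flux

variable (G₂ : SimpleGraph (Site 2)) [G₂.LocallyFinite]
variable (Λ : Finset (Site 2)) (η : SpinConfig (Site 2)) (B : Finset (Site 2)) (cut : Site 2 → Finset (Sym2 (Site 2)))

/-- A signed corner value squares to the corner value squared. [folklore] -/
theorem sign_mul_kcS_sq {s : ℝ} (hs : s = 1 ∨ s = -1) (T : Finset (Sym2 (Site 2))) (v : Site 2) :
    (s * kcS G₂ Λ criticalBetaTwo (.fixed η) B T v) ^ 2 = kcCorner G₂ Λ criticalBetaTwo (.fixed η) B T v ^ 2 := by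
  have h1 : s ^ 2 = 1 := by rcases hs with rfl | rfl <;> norm_num
  have h2 : kcSigma B v T ^ 2 = 1 := by rw [sq]; exact kcSigma_mul_self B v T
  rw [mul_pow, h1, one_mul, kcS, mul_pow, h2, one_mul]

/-- The flux of `kcObs` at `(y, NE)`. [cite: ChelkakHonglerIzyurovAnnals2015, Prop. 3.6] -/
theorem cornerFlux_kcObs_zero (y : Site 2) :
    cornerFlux (kcObs G₂ Λ η B cut) (y, 0) = kcFluxConst * kcFlux G₂ Λ criticalBetaTwo (.fixed η) B cut (y, 0) := by
  unfold cornerFlux kcFlux kcFluxConst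
  simp only [cFace, cSrc, kcObs_east]
  rw [norm_projLine_cornerLine_sq 0 y 0 (n := 0) (by norm_num), kcObsH, re_frameCoord_kcVec_zero, mul_pow,
    sign_mul_kcS_sq G₂ Λ η B (rowSign_cases B (y 1))]
  simp only [pow_zero, mul_one]
  ring

/-- The flux of `kcObs` at `(y, NW)`. [cite: ChelkakHonglerIzyurovAnnals2015, Prop. 3.6] -/
theorem cornerFlux_kcObs_one (y : Site 2) :
    cornerFlux (kcObs G₂ Λ η B cut) (y, 1) = kcFluxConst * kcFlux G₂ Λ criticalBetaTwo (.fixed η) B cut (y, 1) := by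
  have hs2 : Real.sqrt 2 ^ 2 = 2 := Real.sq_sqrt zero_le_two
  unfold cornerFlux kcFlux kcFluxConst
  simp only [cFace, cSrc, kcObs_north]
  rw [norm_projLine_cornerLine_sq 0 y 1 (n := 1) (by norm_num), kcObsV, (re_frameCoord_kcVecV 0 _ _).1, mul_pow,
    sign_mul_kcS_sq G₂ Λ η B (rowSign_cases B (y 1)), frameNorm_succ, mul_pow, hs2]
  ring

/-- The flux of `kcObs` at `(y, SW)`. [cite: ChelkakHonglerIzyurovAnnals2015, Prop. 3.6] -/
theorem cornerFlux_kcObs_two (y : Site 2) :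
    cornerFlux (kcObs G₂ Λ η B cut) (y, 2) = kcFluxConst * kcFlux G₂ Λ criticalBetaTwo (.fixed η) B cut (y, 2) := by
  obtain ⟨w0, -, wf3, -⟩ := westSite_facts y
  unfold cornerFlux kcFlux kcFluxConst
  simp only [cFace, cSrc]
  rw [westBond_eq, kcObs_east, norm_projLine_cornerLine_sq 0 y 2 (n := 2) (by norm_num), kcObsH,
    (re_frameCoord_kcVecH 0 _ _).2.1, wf3, w0, mul_pow, mul_pow, sign_mul_kcS_sq G₂ Λ η B (hLowSign_cases B (y + cornerUnit 2))]
  ring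

/-- The flux of `kcObs` at `(y, SE)`. [cite: ChelkakHonglerIzyurovAnnals2015, Prop. 3.6] -/
theorem cornerFlux_kcObs_three (y : Site 2) :
    cornerFlux (kcObs G₂ Λ η B cut) (y, 3) = kcFluxConst * kcFlux G₂ Λ criticalBetaTwo (.fixed η) B cut (y, 3) := by
  obtain ⟨s0, -, sf0, -⟩ := southSite_facts y
  have hs2 : Real.sqrt 2 ^ 2 = 2 := Real.sq_sqrt zero_le_two
  unfold cornerFlux kcFlux kcFluxConst
  simp only [cFace, cSrc]
  rw [southBond_eq, kcObs_north, norm_projLine_cornerLine_sq 0 y 3 (n := 3) (by norm_num), kcObsV,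
    (re_frameCoord_kcVecV 0 _ _).2.2.1, sf0, s0, mul_pow, mul_pow,
    sign_mul_kcS_sq G₂ Λ η B (vLowSign_cases B cut (y + cornerUnit 3)), frameNorm_succ, mul_pow, hs2]
  ring

/-- **The fluxes of `kcObs` are `c_KC · X²` at every corner.** [cite: ChelkakHonglerIzyurovAnnals2015, Prop. 3.6; Smirnov2010, Lemma 3.6] -/
theorem cornerFlux_kcObs (q : Site 2 × Fin 4) :
    cornerFlux (kcObs G₂ Λ η B cut) q = kcFluxConst * kcFlux G₂ Λ criticalBetaTwo (.fixed η) B cut q := by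
  obtain ⟨y, k⟩ := q
  fin_cases k
  · exact cornerFlux_kcObs_zero G₂ Λ η B cut y
  · exact cornerFlux_kcObs_one G₂ Λ η B cut y
  · exact cornerFlux_kcObs_two G₂ Λ η B cut y
  · exact cornerFlux_kcObs_three G₂ Λ η B cut y

end Flux

end Literature.Probability.LatticeModels
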